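import Summits.Ventures.DiscreteObjects.PP12.FlagTenConjunctR1
import Summits.Ventures.DiscreteObjects.PP12.FlagTenConjunctC1Fin

/-!
# The `f = 10` flag-cell orbit data: conjunct 5 ((R1)) of `IsFlagTenOrbitMatrix`, transported (kernel; Step D)
Framing: lottery ticket; floor = certified bounds/negative ranges.

Cell pub-namedobj (venture DiscreteObjects), target (M), designs gen 14 (HOME designs-g13 FAMILY-FLAG7X §7c). For the orbit data
`D := flagTenDataOfPlane …` read off a putative projective plane of order 12 with a flag-type collineation `σ`, `σ³ = 1`, `f = 10`:
conjunct 5, `∀ i ≠ i', #{j : D.γ j i = D.γ j i'} = if (D.φ i = i' ∨ D.φ i' = i) then 0 else 2` (**`flagTenDataOfPlane_R1`**) — the transport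
of `FlagTenConjunctR1.side_pair_count` along `eTri`/`eFixL`/`eOrbOn`. No `sorry`, no new axioms.
-/

namespace Summit.Ventures.DiscreteObjects.PP12

open Configuration Finset
open scoped Classical

namespace Collineation

variable {P L : Type*} [Membership P L] [ProjectivePlane P L] [Fintype P] [Fintype L] (σ : Collineation P L)

section Data

variable {l : L} {c : P} (hl : σ.onLines l = l) (hc : σ.onPoints c = c) (hcl : c ∈ l)
  (hP : ∀ p : P, σ.onPoints p = p → p ∈ l) (hL : ∀ m : L, σ.onLines m = m → c ∈ m) (h12 : ProjectivePlane.order P L = 12)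
  (hq : σ.onPoints ^ 3 = 1) (hf : fixedCard σ.onPoints = 10) {u₀ : L} (hcu₀ : c ∈ u₀) (hu₀ : σ.onLines u₀ ≠ u₀)

set_option maxHeartbeats 400000 in
/-- **Conjunct 5 ((R1)).** (Heartbeats raised for the lane build's headroom, as for `flagTenDataOfPlane_C4`.) -/
theorem flagTenDataOfPlane_R1 (i i' : Fin 12) (hii' : i ≠ i') :
    (univ.filter fun j : Fin 9 => (σ.flagTenDataOfPlane hl hc hcl hP hL h12 hq hf hcu₀ hu₀).γ j i =
        (σ.flagTenDataOfPlane hl hc hcl hP hL h12 hq hf hcu₀ hu₀).γ j i').card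
      = if (σ.flagTenDataOfPlane hl hc hcl hP hL h12 hq hf hcu₀ hu₀).φ i = i' ∨
            (σ.flagTenDataOfPlane hl hc hcl hP hL h12 hq hf hcu₀ hu₀).φ i' = i then 0 else 2 := by
  set D := σ.flagTenDataOfPlane hl hc hcl hP hL h12 hq hf hcu₀ hu₀ with hD
  set e := eTri (P := P) h12 hcu₀ with he
  set x := e i with hx
  set x' := e i' with hx'
  have hxx' : x.1 ≠ x'.1 := fun h => hii' (e.injective (Subtype.ext h))
  have hγ : ∀ (j : Fin 9) (i₀ : Fin 12), D.γ j i₀ = (σ.eOrbOn hc hcl hP hL h12 hq (σ.eFixL hl hc hf j)).symm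
      ⟨σ.gammaOrb l c (σ.eFixL hl hc hf j).1 (e i₀).1,
        (σ.gammaOrb_mem hl hc hP hL (σ.exterior_of_mem_cline hL hcu₀ hu₀ (e i₀).2.1 (e i₀).2.2) (σ.eFixL hl hc hf j).2.1).1⟩ :=
    fun j i₀ => rfl
  have hφ : ∀ i₀ : Fin 12, (e (D.φ i₀)).1 = σ.phiVertex l c u₀ (e i₀).1 := by
    intro i₀
    change (e ((((e.trans (σ.phiEquiv hl hc hcl hP hL h12 hq hf hcu₀ hu₀)).trans e.symm)) i₀)).1 = _
    simp only [Equiv.trans_apply, Equiv.apply_symm_apply]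
    rfl
  -- the count, rewritten at plane level
  have hset : (univ.filter fun j : Fin 9 => D.γ j i = D.γ j i') =
      univ.filter fun j : Fin 9 => σ.gammaOrb l c (σ.eFixL hl hc hf j).1 x.1 = σ.gammaOrb l c (σ.eFixL hl hc hf j).1 x'.1 := by
    ext j
    simp only [mem_filter, mem_univ, true_and, hγ]
    constructor
    · intro h
      exact congrArg Subtype.val ((σ.eOrbOn hc hcl hP hL h12 hq (σ.eFixL hl hc hf j)).symm.injective h)
    · intro h
      exact congrArg _ (Subtype.ext h)
  rw [hset]
  have h1 := σ.card_filter_eFixL hl hc hf (fun m => σ.gammaOrb l c m x.1 = σ.gammaOrb l c m x'.1)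
  have hv := σ.side_pair_count hl hc hcl hP hL h12 hq hf hcu₀ hu₀ x.2.1 x.2.2 x'.2.1 x'.2.2 hxx'
  -- the conditions agree
  have hiff : ∀ {i₁ i₂ : Fin 12}, D.φ i₁ = i₂ ↔ σ.phiVertex l c u₀ (e i₁).1 = (e i₂).1 := by
    intro i₁ i₂
    rw [← hφ]
    constructor
    · intro h; rw [h]
    · intro h; exact e.injective (Subtype.ext h)
  have hR : (if D.φ i = i' ∨ D.φ i' = i then 0 else 2) =
      (if σ.phiVertex l c u₀ x.1 = x'.1 ∨ σ.phiVertex l c u₀ x'.1 = x.1 then 0 else 2) := by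
    by_cases hcond : σ.phiVertex l c u₀ x.1 = x'.1 ∨ σ.phiVertex l c u₀ x'.1 = x.1
    · rw [if_pos hcond, if_pos (hcond.imp hiff.2 hiff.2)]
    · rw [if_neg hcond, if_neg (fun h => hcond (h.imp hiff.1 hiff.1))]
  rw [hR, ← hv]
  convert h1 using 2 <;> (ext z; simp only [mem_filter, mem_univ, true_and])

end Data

end Collineation

end Summit.Ventures.DiscreteObjects.PP12
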